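import Mathlib.Geometry.Manifold.IntegralCurve.ExistUnique
import Mathlib.Analysis.Calculus.MeanValue
import Summits.FinalStateConjecture.FinalStateConjecture.Theorems.PhotonSphereChannelsTameHullDefs
import HarnessLib

/-!
# Route PhotonSphereChannels · crux `ChannelsResolveTameDevelopmentsR` — horizon generator segments
(helper of line `isolated-kerr-connected-hull`, stubs K and R; supports stmt-FinalStateConjecture-14075)

The stubs K (`stub_clopenAlongGenerators`) and R (`stub_recurrentCoreRigidity`) of the skeleton
`Cruxes/ChannelsResolveTameDevelopmentsR` quantify over GENERATORS THROUGH A HORIZON POINT of an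
end datum `E : TameHull.EndDatum 𝓢` (skeleton §1 `IsGeneratorThrough 𝓢 E p γ`: a continuous causal
curve on `E.horizon` with `γ 0 = p` and `E.clock (γ s) = E.clock p + s` for all `s ∈ ℝ`). This file
proves what the landed vocabulary (`TameHull.EndDatum.IsSilentHorizon`: a clock-normalised future
null generator field `L`, `C^∞` near the horizon, under whose flow the horizon is FORWARD invariant)
actually yields, over Mathlib's integral curves (`IsMIntegralCurve`, Picard–Lindelöf
`exists_isMIntegralCurveAt_of_contMDiffAt_boundaryless`) and the prelude's causal structure
(`LorentzianMetric.causalFuture`, `velocity`):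

* `velocity_eq_of_hasMFDerivAt` — the velocity of an integral curve of `L` is `L`;
* `hasDerivAt_comp_of_mvfderiv_eq_one`, `comp_eq_add_on_Icc_of_mvfderiv_eq_one`,
  `comp_eq_add_of_isMIntegralCurve` — a clock with `dclock(L) = 1` along an integral curve of `L`
  is a unit-rate parameter: `clock (γ s) = clock (γ a) + (s - a)` (chain rule + mean value theorem);
* `EndDatum.generator_of_isMIntegralCurve` — a COMPLETE integral curve of a future-directed
  clock-normalised field which stays on `E.horizon` for all parameters satisfies, verbatim, the five
  clauses of the skeleton's `IsGeneratorThrough` (continuity, base point, confinement, clock, and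
  causality `γ s' ∈ J⁺(γ s)` for `s ≤ s'`);
* `EndDatum.IsSilentHorizon.exists_forward_segment` — at every point of a silent horizon there is a
  forward generator SEGMENT: defined near `0`, on the horizon, future-directed causal and
  clock-parametrised on `[0, ε]`.

What is NOT here (and is in no hypothesis of the line): completeness of the integral curve and
BACKWARD invariance of `E.horizon` under the flow of `L` — the exact residue separating the segment
from a full generator (recorded as the missing statement `HorizonGeneratorsExist` in the lead's
census of stub K). Wald 1984, §12.1 (generators of the event horizon); O'Neill 1983, Ch. 1,
Prop. 1.16 ff. (integral curves). [cite: Wald1984, §12.1]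
-/

noncomputable section

-- every `Summit.FinalStateConjecture.FinalStateConjecture.…` name repeats the summit = sub-problem
-- segment (D-0017 layout; as in `PhotonSphereChannelsTameHullDefs`)
set_option linter.dupNamespace false

open Set Filter Function Manifold Bundle
open scoped Topology Manifold ContDiff

namespace Summit.FinalStateConjecture.FinalStateConjecture.Theorems.TameHull

open Literature.Geometry.Lorentzian

variable {𝓢 : Spacetime.{0} 4}

-- `TangentSpace 𝓘(ℝ, ℝ) t` is definitionally `ℝ`; evaluating the derivative of a curve at the unit
-- vector, or reading the manifold derivative of a real function of a real variable as an ordinary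
-- derivative, moves across this identification — as in Mathlib's
-- `IsMIntegralCurveOn.hasDerivWithinAt` and the prelude's
-- `RedShiftedHorizon.monotoneOn_comp_of_isMIntegralCurveOn` (same option, same proof pattern).
set_option backward.isDefEq.respectTransparency false in
/-- The velocity of an integral curve of `L` is `L`: if `dγ_t = (r ↦ r • L (γ t))` then
`γ'(t) = L (γ t)`. O'Neill 1983, Ch. 1, Def. 1.15 ff. [folklore] -/
theorem velocity_eq_of_hasMFDerivAt {γ : ℝ → 𝓢.carrier}
    {L : Π x : 𝓢.carrier, TangentSpace (𝓡 4) x} {t : ℝ}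
    (h : HasMFDerivAt 𝓘(ℝ, ℝ) (𝓡 4) γ t ((1 : ℝ →L[ℝ] ℝ).smulRight (L (γ t)))) :
    velocity (𝓡 4) γ t = L (γ t) := by
  rw [velocity, h.mfderiv]
  change ((1 : ℝ →L[ℝ] ℝ) (1 : ℝ)) • L (γ t) = L (γ t)
  simp

set_option backward.isDefEq.respectTransparency false in
/-- Chain rule along an integral curve: if `γ` has velocity `L (γ t)` at `t` and
`dclock(L (γ t)) = 1`, then `(clock ∘ γ)'(t) = 1`. [folklore] -/
theorem hasDerivAt_comp_of_mvfderiv_eq_one {L : Π x : 𝓢.carrier, TangentSpace (𝓡 4) x}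
    {clock : 𝓢.carrier → ℝ} {γ : ℝ → 𝓢.carrier} {t : ℝ}
    (hγ : HasMFDerivAt 𝓘(ℝ, ℝ) (𝓡 4) γ t ((1 : ℝ →L[ℝ] ℝ).smulRight (L (γ t))))
    (h1 : mvfderiv (𝓡 4) clock (γ t) (L (γ t)) = 1) : HasDerivAt (clock ∘ γ) 1 t := by
  -- `clock` is differentiable at `γ t` (otherwise `mvfderiv = 0 ≠ 1`)
  have ht : MDifferentiableAt (𝓡 4) 𝓘(ℝ, ℝ) clock (γ t) := by
    by_contra hnd
    have h0 : mfderiv (𝓡 4) 𝓘(ℝ, ℝ) clock (γ t) = 0 :=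
      mfderiv_zero_of_not_mdifferentiableAt hnd
    have : mvfderiv (𝓡 4) clock (γ t) (L (γ t)) = 0 := by simp [mvfderiv, h0]
    rw [this] at h1
    exact zero_ne_one h1
  rw [hasDerivAt_iff_hasFDerivAt, ← hasMFDerivAt_iff_hasFDerivAt]
  apply (ht.hasMFDerivAt.comp t hγ).congr_mfderiv
  rw [ContinuousLinearMap.ext_iff]
  intro r
  have h1' : mfderiv (𝓡 4) 𝓘(ℝ, ℝ) clock (γ t) (L (γ t)) = (1 : ℝ) := h1
  rw [ContinuousLinearMap.comp_apply, ContinuousLinearMap.smulRight_apply, map_smul, h1']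
  rfl

/-- **A clock with `dclock(L) = 1` is a unit-rate parameter along integral curves of `L`**
(segment form): if `γ` has velocity `L ∘ γ` on `[a, b]` and `dclock(L) = 1` along it, then
`clock (γ s) = clock (γ a) + (s - a)` on `[a, b]` (`s ↦ clock (γ s) - s` has derivative `0`;
mean value theorem, `constant_of_has_deriv_right_zero`). [folklore] -/
theorem comp_eq_add_on_Icc_of_mvfderiv_eq_one {L : Π x : 𝓢.carrier, TangentSpace (𝓡 4) x}
    {clock : 𝓢.carrier → ℝ} {γ : ℝ → 𝓢.carrier} {a b : ℝ}
    (hγ : ∀ t ∈ Icc a b, HasMFDerivAt 𝓘(ℝ, ℝ) (𝓡 4) γ t ((1 : ℝ →L[ℝ] ℝ).smulRight (L (γ t))))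
    (h1 : ∀ t ∈ Icc a b, mvfderiv (𝓡 4) clock (γ t) (L (γ t)) = 1) :
    ∀ s ∈ Icc a b, clock (γ s) = clock (γ a) + (s - a) := by
  have hd : ∀ t ∈ Icc a b, HasDerivAt (fun s ↦ clock (γ s) - s) (1 - 1) t :=
    fun t ht ↦ (hasDerivAt_comp_of_mvfderiv_eq_one (hγ t ht) (h1 t ht)).sub (hasDerivAt_id t)
  have hc := constant_of_has_deriv_right_zero (f := fun s ↦ clock (γ s) - s) (a := a) (b := b)
    (fun t ht ↦ (hd t ht).continuousAt.continuousWithinAt)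
    (fun t ht ↦ by simpa using (hd t (Ico_subset_Icc_self ht)).hasDerivWithinAt)
  intro s hs
  have h := hc s hs
  linarith

/-- Global form: along a COMPLETE integral curve of `L` confined to a set on which
`dclock(L) = 1`, `clock (γ s) = clock (γ 0) + s` for every `s ∈ ℝ`. [folklore] -/
theorem comp_eq_add_of_isMIntegralCurve {L : Π x : 𝓢.carrier, TangentSpace (𝓡 4) x}
    {clock : 𝓢.carrier → ℝ} {S : Set 𝓢.carrier}
    (hS : ∀ p ∈ S, mvfderiv (𝓡 4) clock p (L p) = 1) {γ : ℝ → 𝓢.carrier}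
    (hγ : IsMIntegralCurve γ L) (hmem : ∀ s, γ s ∈ S) (s : ℝ) :
    clock (γ s) = clock (γ 0) + s := by
  rcases le_total 0 s with hs | hs
  · have h := comp_eq_add_on_Icc_of_mvfderiv_eq_one (fun t _ ↦ hγ t) (fun t _ ↦ hS _ (hmem t))
      s ⟨hs, le_rfl⟩
    simpa using h
  · have h := comp_eq_add_on_Icc_of_mvfderiv_eq_one (fun t _ ↦ hγ t) (fun t _ ↦ hS _ (hmem t))
      0 ⟨hs, le_rfl⟩
    linarith

/-- **A complete, horizon-confined integral curve of a future-directed clock-normalised field is a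
generator through its base point** — verbatim the five clauses of the skeleton's
`IsGeneratorThrough 𝓢 E p γ` (so that `exact` closes it there): continuity
(`IsMIntegralCurve.continuous`), `γ 0 = p`, confinement, `clock (γ s) = clock p + s`
(`comp_eq_add_of_isMIntegralCurve`), and causality: for `s < s'` the restriction to `[s, s']` is a
future causal curve (its velocity is `L ∘ γ`, future-directed on the horizon), for `s = s'` use
`{γ s} ⊆ J⁺({γ s})`. The residue of the generator construction of stubs K/R is thus exactly the
hypotheses `hγ` (completeness) and `hmem` (two-sided confinement). Wald 1984, §12.1. [folklore] -/
theorem EndDatum.generator_of_isMIntegralCurve (E : EndDatum 𝓢)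
    {L : Π x : 𝓢.carrier, TangentSpace (𝓡 4) x}
    (hfut : ∀ p ∈ E.horizon, 𝓢.timeOrientation.IsFutureDirected (L p))
    (hclock : ∀ p ∈ E.horizon, mvfderiv (𝓡 4) E.clock p (L p) = 1)
    {p : 𝓢.carrier} {γ : ℝ → 𝓢.carrier} (hγ : IsMIntegralCurve γ L) (h0 : γ 0 = p)
    (hmem : ∀ s, γ s ∈ E.horizon) :
    Continuous γ ∧ γ 0 = p ∧ (∀ s, γ s ∈ E.horizon) ∧ (∀ s, E.clock (γ s) = E.clock p + s) ∧
      ∀ s s' : ℝ, s ≤ s' → γ s' ∈ 𝓢.metric.causalFuture 𝓢.timeOrientation {γ s} := by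
  refine ⟨hγ.continuous, h0, hmem, fun s ↦ ?_, fun s s' hss' ↦ ?_⟩
  · rw [← h0]
    exact comp_eq_add_of_isMIntegralCurve hclock hγ hmem s
  · rcases hss'.eq_or_lt with rfl | hlt
    · exact Or.inl (mem_singleton _)
    · refine Or.inr ⟨γ s, mem_singleton _, γ, s, s', hlt, fun t _ ↦ ?_, rfl, rfl⟩
      refine ⟨(hγ t).mdifferentiableAt, ?_⟩
      rw [velocity_eq_of_hasMFDerivAt (hγ t)]
      exact hfut _ (hmem t)

/-- **Forward generator segments exist at every point of a silent horizon.** The integral curve of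
the generator field `L` of `E.IsSilentHorizon` through `p ∈ E.horizon` exists near `0`
(Picard–Lindelöf on the boundaryless carrier; `L` is `C^∞` on an open neighbourhood of the
horizon), stays on the horizon for small NONNEGATIVE parameters (forward invariance clause), is
future-directed causal there (its velocity is `L`), and is clock-parametrised:
`E.clock (γ s) = E.clock p + s` on `[0, ε]` (`dclock(L) = 1` on the horizon). Nothing is claimed
for negative parameters or for large ones: backward invariance and completeness are not in the
vocabulary. Wald 1984, §12.1; O'Neill 1983, Ch. 1, Prop. 1.16 ff. [folklore] -/
theorem EndDatum.IsSilentHorizon.exists_forward_segment {E : EndDatum 𝓢}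
    [𝓢.metric.HasLeviCivita] (hE : E.IsSilentHorizon) {p : 𝓢.carrier} (hp : p ∈ E.horizon) :
    ∃ (γ : ℝ → 𝓢.carrier) (ε : ℝ), 0 < ε ∧ γ 0 = p ∧ ContinuousOn γ (Icc 0 ε) ∧
      (∀ s ∈ Icc 0 ε, γ s ∈ E.horizon) ∧
      (∀ s ∈ Icc 0 ε, 𝓢.timeOrientation.IsFutureDirected (velocity (𝓡 4) γ s)) ∧
      ∀ s ∈ Icc 0 ε, E.clock (γ s) = E.clock p + s := by
  obtain ⟨L, ⟨𝒩, h𝒩, hsub, hL⟩, hpt, hinv⟩ := hE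
  have h1 : (1 : ℕ∞ω) ≤ ((⊤ : ℕ∞) : ℕ∞ω) := WithTop.coe_le_coe.mpr le_top
  have hLp : ContMDiffAt (𝓡 4) (𝓡 4).tangent 1
      (fun x : 𝓢.carrier ↦ (TotalSpace.mk' E4 x (L x) : TangentBundle (𝓡 4) 𝓢.carrier)) p :=
    (hL.contMDiffAt (h𝒩.mem_nhds (hsub hp))).of_le h1
  obtain ⟨γ, hγ0, hγ⟩ := exists_isMIntegralCurveAt_of_contMDiffAt_boundaryless 0 hLp
  obtain ⟨ε, hε, hγε⟩ := isMIntegralCurveAt_iff'.1 hγ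
  have hball : Icc 0 (ε / 2) ⊆ Metric.ball (0 : ℝ) ε := fun s hs ↦ by
    rw [Metric.mem_ball, Real.dist_eq, sub_zero, abs_lt]
    constructor <;> linarith [hs.1, hs.2]
  -- differentiability with velocity `L ∘ γ` at every point of `[0, ε/2]` (the ball is open)
  have hAt : ∀ s ∈ Icc 0 (ε / 2),
      HasMFDerivAt 𝓘(ℝ, ℝ) (𝓡 4) γ s ((1 : ℝ →L[ℝ] ℝ).smulRight (L (γ s))) :=
    fun s hs ↦ (hγε s (hball hs)).hasMFDerivAt (Metric.isOpen_ball.mem_nhds (hball hs))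
  -- forward invariance: the segment stays on the horizon
  have hmem : ∀ s ∈ Icc 0 (ε / 2), γ s ∈ E.horizon := fun s hs ↦
    hinv γ 0 s hs.1 (hγε.mono ((Icc_subset_Icc_right hs.2).trans hball)) (hγ0 ▸ hp)
  refine ⟨γ, ε / 2, half_pos hε, hγ0, (hγε.continuousOn).mono hball, hmem, fun s hs ↦ ?_,
    fun s hs ↦ ?_⟩
  · rw [velocity_eq_of_hasMFDerivAt (hAt s hs)]
    exact (hpt _ (hmem s hs)).2.1
  · have h := comp_eq_add_on_Icc_of_mvfderiv_eq_one hAt (fun t ht ↦ (hpt _ (hmem t ht)).2.2.1)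
      s hs
    rw [hγ0, sub_zero] at h
    exact h

/-- **Registered helper sub-goal `stubK_forwardGeneratorSegment` of stub K** (binder-free form of
`EndDatum.IsSilentHorizon.exists_forward_segment`, the shape registered on the crux item): at every
point of a silent horizon of an end datum there is a forward generator segment — on the horizon,
future-directed causal, clock-parametrised on `[0, ε]`. Wald 1984, §12.1. [folklore] -/
theorem stubK_forwardGeneratorSegment :
    ∀ (𝓢 : Spacetime.{0} 4) (E : EndDatum 𝓢) [𝓢.metric.HasLeviCivita], E.IsSilentHorizon →
      ∀ p ∈ E.horizon, ∃ (γ : ℝ → 𝓢.carrier) (ε : ℝ), 0 < ε ∧ γ 0 = p ∧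
        ContinuousOn γ (Icc 0 ε) ∧ (∀ s ∈ Icc 0 ε, γ s ∈ E.horizon) ∧
        (∀ s ∈ Icc 0 ε, 𝓢.timeOrientation.IsFutureDirected (velocity (𝓡 4) γ s)) ∧
        ∀ s ∈ Icc 0 ε, E.clock (γ s) = E.clock p + s :=
  fun _ _ _ hE _ hp ↦ hE.exists_forward_segment hp

end Summit.FinalStateConjecture.FinalStateConjecture.Theorems.TameHull

end
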